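import Summits.ResolutionOfSingularities.ResolutionOfSingularities.Theorems.RadicialJungCleanModelsLocalMonomializationAlongCoarsening
import Literature.AlgebraicGeometry.Resolution.RankOneReductionProofs
import Summits.ResolutionOfSingularities.ResolutionOfSingularities.Theorems.RadicialJungCleanModelsNSCoordinateLiftPoly
import HarnessLib

/-!
# The COORDINATE LIFT of the repaired weak-embedded rank-one reduction of `hMono_4`: adjoining `z_l / z₀` for a quasi-regular residue family keeps the centre of `ν₁` EXTENDED (item (3d) of the census)

Route `RadicialJung`, crux `CleanModels` (stmt-ResolutionOfSingularities-15917), registered skeleton `Cruxes/CleanModels/Lines/Sketch.lean`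
rev 35 (sha16 de44649d8f729c3b), stub 7 `stub_cleanModelsDimGEFour`.  Explicit-unit seat `decomp-res-hand-2` g5 (structural hand), memo
`Cruxes/CleanModels/Lines/Sketch-memo-hand2-g5-stubs-5-7.md` §2; g4 memo §2b (the Whitney-umbrella CAVEAT on Novacoski–Spivakovsky 2012 §3.2:
after a Cor. 2.17 lift the centre `𝔭⁽ⁿ⁾` of `ν₁` need not be `𝔭 R⁽ⁿ⁾`) and §5 item (3d).  OURS; structural bookkeeping, counted 0; nothing here proves
resolution of singularities in characteristic `p`.

THE REPAIR, as a theorem.  Let `ν = ν₁ ∘ ν₂` (`O ≤ O₁`), `A ⊆ O` an affine model, `L = locAtCentre A O` its local ring at the centre of `ν`,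
`𝔭_L ⊆ L` the centre of `ν₁`, and `z₀, z₁, …, z_s ∈ A` with `ν(z₀) ≤ ν(z_l)`, `ν(z₀) > 0 = ν₁`-value of `z₀` (a `ν₁`-UNIT in the maximal ideal)
such that the residues `(z̄₀, z̄₁, …, z̄_s)` form a QUASI-REGULAR sequence of the residue ring `L / 𝔭_L` (Matsumura §16; e.g. part of a regular
system of parameters of a regular `L / 𝔭_L` — the coordinate centres of Cossart–Jannsen–Saito blowing ups on the residue side).  Then for the
model `A' = A[z₁/z₀, …, z_s/z₀]` (a chart of the blowing up along `(z₀, …, z_s)`, the LIFT of the residue-side blowing up along `(z̄₀, …, z̄_s)`):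

* `centre_locAtCentre_adjoin_div_le_map` — **the centre of `ν₁` on `L' = locAtCentre A' O` is EXTENDED from `L`: `𝔭_{L'} = 𝔭_L · L'`**
  (with `locAtCentre A' O₁ = locAtCentre A O₁`, `A' ⊆ O` finitely generated).  Proof: for `f = N(z/z₀) ∈ 𝔭_{L'}`, `N ∈ L[T]` of degree `≤ d`,
  the form `H = T₀^d N(T/T₀)` has `H(z₀, z) = z₀^d f ∈ 𝔭_L`, so by quasi-regularity every coefficient of `N` lies in `(z₀, z) + 𝔭_L`; substituting,
  `f ∈ 𝔭_L L' + z₀ · Ñ(z/z₀)` with `Ñ ∈ L[T]` again of positive `ν₁`-value; iterating, `f ∈ ⋂_M (𝔭_L L' + z₀^M L') = 𝔭_L L'` by Krull's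
  intersection theorem in the Noetherian local ring `L' / 𝔭_L L'`.  (So with `𝔭_L = (Y) L` one gets `𝔭_{L'} = (Y) L'`; adjoining `Y/z₀` then gives
  `(Y/z₀)`, and ✓ `exists_model_centre_eq_span_of_local` returns to a model-level `𝔭 = (Y)`.)
(The homogenisation / substitution steps are `coeff_mem_span_sup_of_isQuasiRegular` / `exists_decomp_of_coeff_mem_span_sup` of the companion file
`RadicialJungCleanModelsNSCoordinateLiftPoly.lean`.)
[cite: NovacoskiSpivakovsky2014, §3.2 and Lemma 2.19] [cite: Matsumura1987, §16 Definition p. 124 and Thm. 16.2]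
-/

noncomputable section

set_option linter.dupNamespace false -- mandated namespace of this single-conjunct summit

open IsLocalRing MvPolynomial
open Literature.AlgebraicGeometry.Resolution

namespace Summit.ResolutionOfSingularities.ResolutionOfSingularities.Theorems.RadicialJung.CleanModels

variable {k K : Type} [Field k] [Field K] [Algebra k K]

/-- **The coordinate lift keeps the centre of `ν₁` extended** (repair of Novacoski–Spivakovsky 2012 §3.2 at the Cor. 2.17 lift, memo §2b of
g4): see the module docstring.  Hypotheses: `z₀ ∈ A` a `ν₁`-unit of positive `ν`-value, `ν`-minimal among `z₀, z₁, …, z_s ∈ A`, with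
`(z̄₀, …, z̄_s)` quasi-regular in `locAtCentre A O ⧸ 𝔭`.  Conclusions for `A' = A ⊔ k[z_l / z₀]`: `A' ⊆ O`, finitely generated,
`locAtCentre A' O₁ = locAtCentre A O₁`, and every element of `locAtCentre A' O` of positive `ν₁`-value lies in the extension of the centre `𝔭` of
`ν₁` on `locAtCentre A O`. [cite: NovacoskiSpivakovsky2014, §3.2 and Lemma 2.19] [cite: Matsumura1987, Thm. 16.2] -/
theorem centre_locAtCentre_adjoin_div_le_map (O O₁ : ValuationSubring K) (hO : O ≤ O₁)
    (A : Subalgebra k K) (hA : A.toSubring ≤ O.toSubring) (hAfg : A.FG)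
    {s : ℕ} (z₀ : K) (z : Fin s → K) (hz₀A : z₀ ∈ A) (hzA : ∀ l, z l ∈ A)
    (hz₀Q : O.valuation z₀ < 1) (hz₀P : O₁.valuation z₀ = 1) (hmin : ∀ l, O.valuation (z l) ≤ O.valuation z₀)
    (hqr : IsQuasiRegular (fun i : Fin (s + 1) =>
      Ideal.Quotient.mk ((maximalIdeal O₁).comap (Subring.inclusion ((locAtCentre_le hA).trans hO)))
        ((Fin.cons (⟨z₀, le_locAtCentre _ _ hz₀A⟩ : locAtCentre A.toSubring O)
          (fun l => (⟨z l, le_locAtCentre _ _ (hzA l)⟩ : locAtCentre A.toSubring O)) :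
            Fin (s + 1) → locAtCentre A.toSubring O) i))) :
    ∃ (_ : (A ⊔ Algebra.adjoin k (Set.range fun l => z l / z₀)).toSubring ≤ O.toSubring),
      (A ⊔ Algebra.adjoin k (Set.range fun l => z l / z₀)).FG ∧
      locAtCentre (A ⊔ Algebra.adjoin k (Set.range fun l => z l / z₀)).toSubring O₁ = locAtCentre A.toSubring O₁ ∧
      ∀ f : locAtCentre (A ⊔ Algebra.adjoin k (Set.range fun l => z l / z₀)).toSubring O,
        O₁.valuation (f : K) < 1 →
          f ∈ ((maximalIdeal O₁).comap (Subring.inclusion ((locAtCentre_le hA).trans hO))).map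
            (Subring.inclusion (locAtCentre_mono O
              (show A.toSubring ≤ (A ⊔ Algebra.adjoin k (Set.range fun l => z l / z₀)).toSubring from
                fun _ hx => (le_sup_left : A ≤ A ⊔ Algebra.adjoin k (Set.range fun l => z l / z₀)) hx))) := by
  classical
  -- notation
  set A' : Subalgebra k K := A ⊔ Algebra.adjoin k (Set.range fun l => z l / z₀) with hA'def
  have hAA' : A ≤ A' := le_sup_left
  have hAA'' : A.toSubring ≤ A'.toSubring := fun x hx => hAA' hx
  have hz₀0 : z₀ ≠ 0 := ne_zero_of_valuation_eq_one hz₀P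
  let g : Fin s → K := fun l => z l / z₀
  have hgO : ∀ l, g l ∈ O := by
    intro l
    rw [← O.valuation_le_one_iff, map_div₀]
    exact div_le_one_of_le₀ (hmin l) zero_le
  have hgA' : ∀ l, g l ∈ A' := fun l => (le_sup_right : Algebra.adjoin k _ ≤ A') (Algebra.subset_adjoin ⟨l, rfl⟩)
  have hk : ∀ c : k, algebraMap k K c ∈ O := fun c => hA (A.algebraMap_mem c)
  have hA'O : A'.toSubring ≤ O.toSubring := by
    have : A' ≤ ({ O.toSubring with algebraMap_mem' := hk } : Subalgebra k K) := by
      refine sup_le (fun x hx => hA hx) (Algebra.adjoin_le ?_)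
      rintro _ ⟨l, rfl⟩; exact hgO l
    exact fun x hx => this hx
  have hA'O₁ : A'.toSubring ≤ O₁.toSubring := hA'O.trans hO
  have hA'fg : A'.FG := by
    have : Algebra.adjoin k (Set.range fun l => z l / z₀) = Algebra.adjoin k ((Finset.univ.image g : Finset K) : Set K) := by
      rw [Finset.coe_image, Finset.coe_univ, Set.image_univ]
    rw [hA'def, this]; exact hAfg.sup ⟨_, rfl⟩
  -- the local rings
  set L := locAtCentre A.toSubring O with hLdef
  set L' := locAtCentre A'.toSubring O with hL'def
  have hLO : L ≤ O.toSubring := locAtCentre_le hA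
  have hL'O : L' ≤ O.toSubring := locAtCentre_le hA'O
  have hLL' : L ≤ L' := locAtCentre_mono O hAA''
  haveI : IsLocalRing L' := isLocalRing_locAtCentre hA'O
  haveI hnoethA' : IsNoetherianRing A'.toSubring := isNoetherianRing_of_fg hA'fg
  haveI hnoethL' : IsNoetherianRing L' :=
    isNoetherianRing_of_ringEquiv _ (locAtCentreEquiv hA'O).toRingEquiv
  -- valuation helpers
  have hν_of_ν₁ : ∀ f : K, f ∈ O → O₁.valuation f < 1 → O.valuation f < 1 := by
    intro f hfO hf1
    by_contra hge
    have hf : O.valuation f = 1 := le_antisymm ((O.valuation_le_one_iff _).mpr hfO) (not_lt.mp hge)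
    have hinvO : f⁻¹ ∈ O := (O.valuation_le_one_iff _).mp (by rw [map_inv₀, hf, inv_one])
    have h1 : O₁.valuation f⁻¹ ≤ 1 := (O₁.valuation_le_one_iff _).mpr (hO hinvO)
    have hf0 : f ≠ 0 := ne_zero_of_valuation_eq_one hf
    rw [map_inv₀] at h1
    have hpos : 0 < O₁.valuation f := by rw [Valuation.pos_iff]; exact hf0
    exact (lt_irrefl _) (lt_of_lt_of_le hf1 ((inv_le_one₀ hpos).mp h1))
  have hν₁_of_ν : ∀ f : K, O.valuation f = 1 → O₁.valuation f = 1 := by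
    intro f hf
    have hfO : f ∈ O := (O.valuation_le_one_iff _).mp hf.le
    have hinvO : f⁻¹ ∈ O := (O.valuation_le_one_iff _).mp (by rw [map_inv₀, hf, inv_one])
    apply le_antisymm ((O₁.valuation_le_one_iff _).mpr (hO hfO))
    have h1 : O₁.valuation f⁻¹ ≤ 1 := (O₁.valuation_le_one_iff _).mpr (hO hinvO)
    rw [map_inv₀] at h1
    have hpos : 0 < O₁.valuation f := by rw [Valuation.pos_iff]; exact ne_zero_of_valuation_eq_one hf
    exact (inv_le_one₀ hpos).mp h1
  -- (α): the local ring at the centre of `ν₁` is unchanged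
  have hα : locAtCentre A'.toSubring O₁ = locAtCentre A.toSubring O₁ := by
    refine locAtCentre_eq_of_mutual_le O₁ A'.toSubring A.toSubring ?_ (fun x hx => le_locAtCentre _ _ (hAA'' hx))
    let R₁ : Subalgebra k K :=
      ({ locAtCentre A.toSubring O₁ with
          algebraMap_mem' := fun c => le_locAtCentre A.toSubring O₁ (A.algebraMap_mem c) } : Subalgebra k K)
    have : A' ≤ R₁ := by
      refine sup_le (fun x hx => le_locAtCentre A.toSubring O₁ hx) (Algebra.adjoin_le ?_)
      rintro _ ⟨l, rfl⟩
      exact ⟨z l, hzA l, z₀, hz₀A, hz₀P, rfl⟩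
    exact fun x hx => this hx
  -- the centre of `ν₁` on `L` and its extension to `L'`
  set PL : Ideal L := (maximalIdeal O₁).comap (Subring.inclusion (hLO.trans hO)) with hPLdef
  have hmemPL : ∀ f : L, f ∈ PL ↔ O₁.valuation (f : K) < 1 := fun f => by
    rw [hPLdef, Ideal.mem_comap, ValuationSubring.valuation_lt_one_iff]; rfl
  let ι : L →+* L' := Subring.inclusion hLL'
  have hιval : ∀ f : L, ((ι f : L') : K) = (f : K) := fun _ => rfl
  set 𝔄 : Ideal L' := PL.map ι with h𝔄def
  have h𝔄val : ∀ f ∈ 𝔄, O₁.valuation ((f : L') : K) < 1 := by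
    have hle : 𝔄 ≤ (maximalIdeal O₁).comap (Subring.inclusion (hL'O.trans hO)) := by
      rw [h𝔄def, Ideal.map_le_iff_le_comap]
      intro f hf
      rw [Ideal.mem_comap, Ideal.mem_comap, ValuationSubring.valuation_lt_one_iff]
      exact (hmemPL f).mp hf
    intro f hf
    have := hle hf
    rw [Ideal.mem_comap, ValuationSubring.valuation_lt_one_iff] at this
    exact this
  have hmem𝔪' : ∀ f : L', f ∈ maximalIdeal L' ↔ O.valuation (f : K) < 1 := fun f => mem_maximalIdeal_locAtCentre_iff hA'O f
  have h𝔄ne : 𝔄 ≠ ⊤ := by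
    intro h
    have h1 : (1 : L') ∈ 𝔄 := h ▸ Submodule.mem_top
    have := h𝔄val 1 h1
    rw [OneMemClass.coe_one, map_one] at this
    exact lt_irrefl _ this
  -- the families
  let z₀L : L := ⟨z₀, le_locAtCentre _ _ hz₀A⟩
  let zL : Fin s → L := fun l => ⟨z l, le_locAtCentre _ _ (hzA l)⟩
  let w : Fin (s + 1) → L := (Fin.cons z₀L zL : Fin (s + 1) → L)
  have hw0 : w 0 = z₀L := by simp [w]
  have hwsucc : ∀ l, w l.succ = zL l := fun l => by simp [w]
  have hqr' : IsQuasiRegular (fun i => Ideal.Quotient.mk PL (w i)) := hqr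
  let gL : Fin s → L' := fun l => ⟨g l, le_locAtCentre _ _ (hgA' l)⟩
  let E : MvPolynomial (Fin s) L →+* L' := eval₂Hom ι gL
  have hz₀𝔪 : ι z₀L ∈ maximalIdeal L' := by rw [hmem𝔪']; exact hz₀Q
  have hz_eq : ∀ l, ι (zL l) = ι z₀L * gL l := fun l => by
    apply Subtype.ext
    change z l = z₀ * (z l / z₀)
    field_simp
  -- KEY STEP: extract one factor `z₀`
  have hstep : ∀ N : MvPolynomial (Fin s) L, O₁.valuation ((E N : L') : K) < 1 →
      ∃ N' : MvPolynomial (Fin s) L, O₁.valuation ((E N' : L') : K) < 1 ∧ E N - ι z₀L * E N' ∈ 𝔄 := by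
    intro N hN
    set d := N.totalDegree with hddef
    have hdegα : ∀ α ∈ N.support, α.degree ≤ d := fun α hα => by
      rw [Finsupp.degree_apply]; exact le_totalDegree hα
    -- the value of the homogenised combination
    have hEK : ((E N : L') : K) = ∑ α ∈ N.support, ((N.coeff α : L) : K) * ∏ l, (g l) ^ (α l) := by
      change (((eval₂Hom ι gL) N : L') : K) = _
      rw [coe_eval₂Hom, eval₂_eq']
      push_cast
      rfl
    have hK : (((∑ α ∈ N.support, N.coeff α * (w 0 ^ (d - α.degree) * ∏ l, w l.succ ^ α l) : L)) : K) =
        z₀ ^ d * ((E N : L') : K) := by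
      rw [hEK, Finset.mul_sum]
      push_cast
      refine Finset.sum_congr rfl fun α hα => ?_
      simp only [hw0, hwsucc]
      change ((N.coeff α : L) : K) * (z₀ ^ (d - α.degree) * ∏ l, z l ^ α l) =
        z₀ ^ d * (((N.coeff α : L) : K) * ∏ l, (z l / z₀) ^ α l)
      have hprod : ∏ l, (z l / z₀) ^ α l = (∏ l, z l ^ α l) / z₀ ^ α.degree := by
        simp only [div_pow]
        rw [Finset.prod_div_distrib, Finset.prod_pow_eq_pow_sum, Finsupp.degree_eq_sum]
      rw [hprod]
      have hsplit : z₀ ^ d = z₀ ^ (d - α.degree) * z₀ ^ α.degree := by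
        rw [← pow_add, Nat.sub_add_cancel (hdegα α hα)]
      rw [hsplit]
      have hz₀pow : z₀ ^ α.degree ≠ 0 := pow_ne_zero _ hz₀0
      field_simp
    have hsum : (∑ α ∈ N.support, N.coeff α * (w 0 ^ (d - α.degree) * ∏ l, w l.succ ^ α l)) ∈ PL := by
      rw [hmemPL, hK, map_mul, map_pow, hz₀P, one_pow, one_mul]
      exact hN
    have hcoeff := coeff_mem_span_sup_of_isQuasiRegular PL w hqr' N d le_rfl hsum
    obtain ⟨P₀, U, hP₀, hNeq⟩ := exists_decomp_of_coeff_mem_span_sup PL w N hcoeff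
    have hEP₀ : E P₀ ∈ 𝔄 := by
      rw [P₀.as_sum, map_sum]
      refine Ideal.sum_mem _ fun α _ => ?_
      change (eval₂Hom ι gL) (monomial α (P₀.coeff α)) ∈ 𝔄
      rw [coe_eval₂Hom, eval₂_monomial]
      exact Ideal.mul_mem_right _ _ (Ideal.mem_map_of_mem ι (hP₀ α))
    set N' : MvPolynomial (Fin s) L := U 0 + ∑ l, X l * U l.succ with hN'def
    have hEN : E N = E P₀ + ι z₀L * E N' := by
      conv_lhs => rw [hNeq]
      rw [map_add, map_sum, Fin.sum_univ_succ]
      simp only [map_mul, hN'def, map_add, map_sum]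
      have hC : ∀ c : L, E (C c) = ι c := fun c => by
        change (eval₂Hom ι gL) (C c) = _; rw [coe_eval₂Hom, eval₂_C]
      have hX : ∀ l, E (X l) = gL l := fun l => by
        change (eval₂Hom ι gL) (X l) = _; rw [coe_eval₂Hom, eval₂_X]
      simp only [hC, hX, hw0, hwsucc, hz_eq]
      have : ∀ x : Fin s, ι z₀L * gL x * E (U x.succ) = ι z₀L * (gL x * E (U x.succ)) := fun x => mul_assoc _ _ _
      simp only [this, ← Finset.mul_sum]
      ring
    refine ⟨N', ?_, ?_⟩
    · have h1 : O₁.valuation (((ι z₀L * E N' : L')) : K) < 1 := by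
        have : ι z₀L * E N' = E N - E P₀ := by rw [hEN]; ring
        rw [this]
        push_cast
        exact lt_of_le_of_lt (Valuation.map_sub _ _ _) (max_lt hN (h𝔄val _ hEP₀))
      rw [Subring.coe_mul, map_mul, hιval, show ((z₀L : L) : K) = z₀ from rfl, hz₀P, one_mul] at h1
      exact h1
    · have : E N - ι z₀L * E N' = E P₀ := by rw [hEN]; ring
      rw [this]; exact hEP₀
  -- ITERATION: `E N ∈ 𝔄 + z₀^M L'` for every `M`
  have hiter : ∀ (M : ℕ) (N : MvPolynomial (Fin s) L), O₁.valuation ((E N : L') : K) < 1 →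
      E N ∈ 𝔄 ⊔ Ideal.span {ι z₀L ^ M} := by
    intro M
    induction M with
    | zero =>
      intro N _
      rw [pow_zero, Ideal.span_singleton_one]
      exact Submodule.mem_sup_right Submodule.mem_top
    | succ M ih =>
      intro N hN
      obtain ⟨N', hN', hdiff⟩ := hstep N hN
      obtain ⟨a, ha, b, hb, hab⟩ := Submodule.mem_sup.mp (ih N' hN')
      obtain ⟨r, hr⟩ := Ideal.mem_span_singleton'.mp hb
      have : E N = (E N - ι z₀L * E N' + ι z₀L * a) + r * ι z₀L ^ (M + 1) := by
        rw [← hab, ← hr]; ring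
      rw [this]
      exact Submodule.add_mem_sup (Ideal.add_mem _ hdiff (Ideal.mul_mem_left _ _ ha))
        (Ideal.mem_span_singleton'.mpr ⟨r, rfl⟩)
  -- KRULL: `⋂_M (𝔄 + z₀^M L') = 𝔄`
  have hkrull : ∀ x : L', (∀ M : ℕ, x ∈ 𝔄 ⊔ Ideal.span {ι z₀L ^ M}) → x ∈ 𝔄 := by
    intro x hx
    haveI : Nontrivial (L' ⧸ 𝔄) := Ideal.Quotient.nontrivial_iff.mpr h𝔄ne
    haveI : IsLocalRing (L' ⧸ 𝔄) :=
      IsLocalRing.of_surjective' (Ideal.Quotient.mk 𝔄) Ideal.Quotient.mk_surjective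
    set J : Ideal (L' ⧸ 𝔄) := Ideal.span {Ideal.Quotient.mk 𝔄 (ι z₀L)} with hJdef
    have hJ : J ≠ ⊤ := by
      intro hJtop
      have hu : IsUnit (Ideal.Quotient.mk 𝔄 (ι z₀L)) := Ideal.span_singleton_eq_top.mp hJtop
      obtain ⟨v, hv⟩ := hu.exists_right_inv
      obtain ⟨v', rfl⟩ := Ideal.Quotient.mk_surjective v
      rw [← map_mul, ← map_one (Ideal.Quotient.mk 𝔄), Ideal.Quotient.eq] at hv
      have h1 : ι z₀L * v' - 1 ∈ maximalIdeal L' := by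
        rw [hmem𝔪']
        exact hν_of_ν₁ _ (hL'O (ι z₀L * v' - 1).2) (h𝔄val _ hv)
      have h2 : ι z₀L * v' ∈ maximalIdeal L' := Ideal.mul_mem_right _ _ hz₀𝔪
      have : (1 : L') ∈ maximalIdeal L' := by
        have := Ideal.sub_mem _ h2 h1
        rwa [sub_sub_cancel] at this
      exact (maximalIdeal.isMaximal L').ne_top (Ideal.eq_top_of_isUnit_mem _ this isUnit_one)
    have hbot := Ideal.iInf_pow_eq_bot_of_isLocalRing J hJ
    have hxJ : ∀ M : ℕ, Ideal.Quotient.mk 𝔄 x ∈ J ^ M := by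
      intro M
      obtain ⟨a, ha, b, hb, hab⟩ := Submodule.mem_sup.mp (hx M)
      obtain ⟨r, hr⟩ := Ideal.mem_span_singleton'.mp hb
      rw [← hab, map_add, Ideal.Quotient.eq_zero_iff_mem.mpr ha, zero_add, ← hr, map_mul, map_pow]
      have hgen : Ideal.Quotient.mk 𝔄 (ι z₀L) ∈ J := Ideal.subset_span (Set.mem_singleton _)
      exact Ideal.mul_mem_left _ _ (Ideal.pow_mem_pow hgen M)
    have hmem : Ideal.Quotient.mk 𝔄 x ∈ (⨅ M : ℕ, J ^ M) := (Submodule.mem_iInf fun M : ℕ => J ^ M).mpr hxJ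
    rw [hbot, Ideal.mem_bot] at hmem
    exact Ideal.Quotient.eq_zero_iff_mem.mp hmem
  -- every element of `A'` is `E N` for some `N`
  have hsurj : ∀ n : K, n ∈ A' → ∃ N : MvPolynomial (Fin s) L, ((E N : L') : K) = n := by
    let T : Subalgebra k K :=
      { carrier := {n | ∃ N : MvPolynomial (Fin s) L, ((E N : L') : K) = n}
        mul_mem' := by
          rintro _ _ ⟨N, rfl⟩ ⟨N', rfl⟩
          exact ⟨N * N', by rw [map_mul, Subring.coe_mul]⟩
        one_mem' := ⟨1, by rw [map_one, OneMemClass.coe_one]⟩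
        add_mem' := by
          rintro _ _ ⟨N, rfl⟩ ⟨N', rfl⟩
          exact ⟨N + N', by rw [map_add, AddMemClass.coe_add]⟩
        zero_mem' := ⟨0, by rw [map_zero, ZeroMemClass.coe_zero]⟩
        algebraMap_mem' := fun c => ⟨C ⟨algebraMap k K c, le_locAtCentre _ _ (A.algebraMap_mem c)⟩, by
          change (((eval₂Hom ι gL) (C _) : L') : K) = _
          rw [coe_eval₂Hom, eval₂_C]; rfl⟩ }
    have hA'T : A' ≤ T := by
      refine sup_le (fun x hx => ?_) (Algebra.adjoin_le ?_)
      · exact ⟨C ⟨x, le_locAtCentre _ _ hx⟩, by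
          change (((eval₂Hom ι gL) (C _) : L') : K) = _
          rw [coe_eval₂Hom, eval₂_C]; rfl⟩
      · rintro _ ⟨l, rfl⟩
        exact ⟨X l, by
          change (((eval₂Hom ι gL) (X l) : L') : K) = _
          rw [coe_eval₂Hom, eval₂_X]⟩
    intro n hn
    exact hA'T hn
  -- CONCLUSION
  refine ⟨hA'O, hA'fg, hα, fun f hf => ?_⟩
  obtain ⟨n, hn, e, he, he1, hfne⟩ := (mem_locAtCentre_iff).mp f.2
  have he0 : e ≠ 0 := ne_zero_of_valuation_eq_one he1
  obtain ⟨N₀, hN₀⟩ := hsurj n hn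
  have hnval : O₁.valuation n < 1 := by
    have : O₁.valuation (f : K) = O₁.valuation n := by
      rw [hfne, map_div₀, hν₁_of_ν e he1, div_one]
    rw [← this]; exact hf
  have hEN₀ : E N₀ ∈ 𝔄 := hkrull _ fun M => hiter M N₀ (by rw [hN₀]; exact hnval)
  let eL : L' := ⟨e, le_locAtCentre _ _ he⟩
  have heunit : IsUnit eL := by
    by_contra hne
    have := (not_isUnit_locAtCentre_iff hA'O eL).mp hne
    change O.valuation e < 1 at this
    rw [he1] at this; exact lt_irrefl _ this
  have : eL * f = E N₀ := by
    apply Subtype.ext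
    change e * (f : K) = ((E N₀ : L') : K)
    rw [hN₀, hfne]; field_simp
  exact (Ideal.unit_mul_mem_iff_mem 𝔄 heunit).mp (this ▸ hEN₀)

end Summit.ResolutionOfSingularities.ResolutionOfSingularities.Theorems.RadicialJung.CleanModels

end
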